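import Mathlib
import HarnessLib
import Literature.Analysis.FluidPDE.KNSSThm53OfWindow
import Literature.Analysis.FluidPDE.FlatSwirlGauge
import Summits.NavierStokesRegularity.NavierStokesRegularity.Theorems.PoloidalWindowDoorPoloidalWindowRigidityOneSliceCurlAxisymmetric
import Summits.NavierStokesRegularity.NavierStokesRegularity.Theorems.PoloidalWindowDoorPoloidalWindowRigidityRotate

/-!
# nsreg-p1 ROUND-18 door S19 «LocalTiltingFreeDoor», LINE 2 support — AXISYMMETRY WITH SWIRL IN THE DOOR CLASS:
# KNSS 2009 Thm 5.3 for door-class profiles, and ONE vorticity slice axisymmetric about ANY vertical axis ⇒ `v ≡ 0`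

Door S19 (nsreg-p1 g16, `HOME/ns-regularity-ideate-p1/ROUND-18.md`; DESIGN-ONLY, route NOT born), LINE 2 skeleton
`r18/TiltingSymmetryGerm_line.lean` 5d1e8887fb878af2.  Its classical stub `stub_symmetricGermsRegular` (M⁺) needs, in its
ROTATION branch, a Liouville theorem for door-class profiles whose vorticity is axisymmetric on one slice — WITHOUT the
poloidal / no-swirl hypothesis under which the `PoloidalWindowDoor` toolkit proved it (KNSS Thm 5.2).  The door class of
S19 is the S16-family class: Type-I time rate `C`, Type-I SPACE–TIME decay `D` about the apex, continuity on the open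
backward slab, unit-viscosity Oseen–Duhamel identity, divergence-free slices; the space–time decay is what buys KNSS
Thm 5.3 (`r‖v‖ ≤ C'`, swirl allowed).

* `eq_zero_of_isAxisymmetric_of_cylBound` — **KNSS 2009 Thm 5.3 in the door class**: slices axisymmetric about the
  vertical axis + `cylRadius y · ‖v(t,y)‖ ≤ C'(δ)` on every shifted slab `t < −δ` ⇒ `v ≡ 0` (time shift ⇒ BOUNDED
  ancient mild, `IsTypeIAncientMild.isBoundedAncientMildSolution_sub`; tree's PROVED `knss_bound_C_over_r_holds`;
  continuity upgrades a.e. to everywhere);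
* `cylBound_conj_translate` — the shifted-slab bound for `x ↦ L v(t, L⁻¹x + c)` from the decay about the apex
  (`|D| + ‖c‖|C|/√δ`), although the translated profile has no space–time Type-I decay about the new axis;
  `eventually_norm_conj_translate_lt` — its slices are small at spatial infinity; `eq_zero_of_periodic_of_small_at_infinity`;
* `eq_zero_of_curl_isAxisymmetric_slice_of_cylBound` / `eq_zero_of_curl_isAxisymmetric_slice` — **(A′₁) with swirl**:
  ONE slice whose VORTICITY is axisymmetric about the vertical axis through ANY `c` ⇒ `v ≡ 0` (nsreg-p7's kinematics
  `sub_apply_zero_isAxisymmetric_of_curl` + zero large-scale momentum `eq_zero_of_slice_sub_eq_const`, verbatim, the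
  KNSS 5.2 ending replaced by the 5.3 ending via `isAxisymmetric_of_slice`);
* `eq_zero_of_curl_rotDefect_eq_zero_on_open` — germ form: the rotational Killing identity `J ω_c = Dω_c[J ·]` on a
  nonempty open set of one slice suffices (`rotDefect_eq_zero_of_eqOn_open`, `isAxisymmetric_of_rotDefect_eq_zero`).

Seat nsreg-p6 g10 (THEOREMS-ONLY door sequels, DIRECTOR-NS g8 #32 (2)/#36).  WHAT THIS IS NOT: not NS regularity
(Clay A); not K2 `TiltingFreeProfileRigidity`, not TSG; nothing here touches hard core 1964/15453 — axisymmetry WITH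
swirl is discharged by the PROVED Type-I theorem KNSS 5.3, never assumed regular; no route is opened.
-/

noncomputable section

-- the summit and its single sub-problem share the name (CONVENTIONS §1), as in every Theorems file
set_option linter.dupNamespace false

namespace Summit.NavierStokesRegularity.NavierStokesRegularity.Theorems.LocalTiltingFreeDoorAxisymmetricSwirl

open MeasureTheory Set Function Filter Topology Metric
open scoped RealInnerProductSpace InnerProductSpace
open Literature.Analysis Literature.Analysis.FluidPDE
open Summit.NavierStokesRegularity.NavierStokesRegularity.Theorems.LocalSineTubeDoorProfileAlignedWindowRigidityAncient
open Summit.NavierStokesRegularity.NavierStokesRegularity.Theorems.PoloidalWindowDoorPoloidalWindowRigidityWindow (isTypeIAncientMild_of_class)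
open Summit.NavierStokesRegularity.NavierStokesRegularity.Theorems.PoloidalWindowDoorPoloidalWindowRigidityAxisymmetric (class_translate)
open Summit.NavierStokesRegularity.NavierStokesRegularity.Theorems.PoloidalWindowDoorPoloidalWindowRigidityRotate (class_conj_linearIsometryEquiv)
open Summit.NavierStokesRegularity.NavierStokesRegularity.Theorems.PoloidalWindowDoorPoloidalWindowRigidityOneSlice (isAxisymmetric_of_slice)
open Summit.NavierStokesRegularity.NavierStokesRegularity.Theorems.PoloidalWindowDoorPoloidalWindowRigidityVorticityAxisymmetric (sub_apply_zero_isAxisymmetric_of_curl)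
open Summit.NavierStokesRegularity.NavierStokesRegularity.Theorems.PoloidalWindowDoorPoloidalWindowRigidityZeroMeanMomentum (eq_zero_of_slice_sub_eq_const)
open Summit.NavierStokesRegularity.NavierStokesRegularity.Theorems.PoloidalWindowDoorPoloidalWindowRigidityOneSliceCurlAxisymmetric (rotZ_eq_self_of_horizontal_eq_zero)
open Summit.NavierStokesRegularity.NavierStokesRegularity.Theorems.PoloidalWindowDoorPoloidalWindowRigiditySymmetryGerms
  (isAxisymmetric_of_rotDefect_eq_zero rotDefect_eq_zero_of_eqOn_open)

variable {C D : ℝ} {v : ℝ → EuclideanSpace ℝ (Fin 3) → EuclideanSpace ℝ (Fin 3)}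

/-! ### KNSS 2009 Thm 5.3 in the door class (swirl allowed) -/

/-- **Axisymmetric profiles of the Type-I class with `r‖v‖` bounded on shifted slabs vanish (KNSS 2009 Thm 5.3, swirl
allowed).**  For a profile of the class (time rate, continuity, Oseen–Duhamel identity, divergence-free slices) whose
slices are all axisymmetric about the vertical coordinate axis and which satisfies `cylRadius y · ‖v(t,y)‖ ≤ C'(δ)` for
`t < −δ`, every `δ > 0`: the time shift `t ↦ v(t − δ)` is a BOUNDED ancient mild solution
(`IsTypeIAncientMild.isBoundedAncientMildSolution_sub`) to which the tree's PROVED `knss_bound_C_over_r_holds` applies;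
continuity of the slices upgrades a.e. to everywhere. -/
theorem eq_zero_of_isAxisymmetric_of_cylBound (hrate : HasTypeITimeDecay C v)
    (hcont : ContinuousOn (uncurry v) (Iio (0 : ℝ) ×ˢ univ))
    (hmild : ∀ s t : ℝ, s < t → t < 0 → ∀ x,
      v t x = UnboundedOperators.heatExtension (v s) (t - s) x - oseenDuhamel 1 s v v t x)
    (hdiv : ∀ t < 0, VectorCalculus.IsDivFree (v t))
    (haxi : ∀ t < 0, IsAxisymmetric (v t))
    (hbound : ∀ δ : ℝ, 0 < δ → ∃ C' : ℝ, ∀ t < -δ, ∀ y, cylRadius y * ‖v t y‖ ≤ C') :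
    ∀ t < 0, ∀ x, v t x = 0 := by
  have hA : IsTypeIAncientMild C v := isTypeIAncientMild_of_class hrate hcont hmild hdiv
  intro t ht
  obtain ⟨δ, hδ0, hδt⟩ : ∃ δ : ℝ, 0 < δ ∧ t + δ < 0 := ⟨-t / 2, by linarith, by linarith⟩
  have hw : IsBoundedAncientMildSolution 1 (fun τ => v (τ - δ)) := hA.isBoundedAncientMildSolution_sub hδ0
  have hmeas : ∀ τ < 0, AEStronglyMeasurable ((fun τ => v (τ - δ)) τ) volume :=
    fun τ hτ => (continuous_slice hcont (by linarith : τ - δ < 0)).aestronglyMeasurable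
  have haxi' : ∀ τ < 0, IsAxisymmetric ((fun τ => v (τ - δ)) τ) := fun τ hτ => haxi _ (by linarith)
  obtain ⟨C', hC'⟩ := hbound δ hδ0
  have hbound' : ∃ C' : ℝ, ∀ τ < 0, ∀ y, cylRadius y * ‖(fun τ => v (τ - δ)) τ y‖ ≤ C' :=
    ⟨C', fun τ hτ y => hC' (τ - δ) (by linarith) y⟩
  have h0 := knss_bound_C_over_r_holds hw hmeas haxi' hbound' (t + δ) hδt
  have h0' : v t =ᵐ[volume] (0 : EuclideanSpace ℝ (Fin 3) → EuclideanSpace ℝ (Fin 3)) := by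
    simpa only [add_sub_cancel_right] using h0
  have hct : Continuous (v t) := continuous_slice hcont ht
  have heq : v t = 0 := (Continuous.ae_eq_iff_eq (μ := volume) hct continuous_const).1 h0'
  intro x
  rw [heq, Pi.zero_apply]

/-- **The `r‖v‖` bound for the translate–conjugate of a profile with space–time decay about the apex.**  If
`‖v(t,z)‖ ≤ C/√(−t)` and `‖v(t,z)‖ ≤ D/(‖z‖ + √(−t))`, then for every linear isometry `L` and centre `c` the field
`x ↦ L v(t, L⁻¹x + c)` satisfies `cylRadius x · ‖L v(t, L⁻¹x + c)‖ ≤ |D| + ‖c‖|C|/√δ` for `t < −δ`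
(`cylRadius x ≤ ‖x‖ = ‖L⁻¹x‖ ≤ ‖L⁻¹x + c‖ + ‖c‖`). -/
theorem cylBound_conj_translate (hrate : HasTypeITimeDecay C v) (hdec : HasTypeIDecay D v)
    (L : EuclideanSpace ℝ (Fin 3) ≃ₗᵢ[ℝ] EuclideanSpace ℝ (Fin 3)) (c : EuclideanSpace ℝ (Fin 3)) :
    ∀ δ : ℝ, 0 < δ → ∃ C' : ℝ, ∀ t < -δ, ∀ x : EuclideanSpace ℝ (Fin 3),
      cylRadius x * ‖L (v t (L.symm x + c))‖ ≤ C' := by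
  intro δ hδ
  refine ⟨|D| + ‖c‖ * (|C| / Real.sqrt δ), fun t ht x => ?_⟩
  have ht0 : t < 0 := by linarith
  set z : EuclideanSpace ℝ (Fin 3) := L.symm x + c with hz
  have hst : 0 < Real.sqrt (-t) := Real.sqrt_pos.2 (by linarith)
  have h1 : ‖v t z‖ ≤ D / (‖z‖ + Real.sqrt (-t)) := hdec t ht0 z
  have h2 : ‖v t z‖ ≤ C / Real.sqrt (-t) := hrate t ht0 z
  have hden : 0 < ‖z‖ + Real.sqrt (-t) := by positivity
  rw [L.norm_map]
  have hcyl : cylRadius x ≤ ‖x‖ := by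
    rw [cylRadius, EuclideanSpace.norm_eq]
    apply Real.sqrt_le_sqrt
    have h : ∑ i : Fin 3, ‖x i‖ ^ 2 = x 0 ^ 2 + x 1 ^ 2 + x 2 ^ 2 := by
      simp [Fin.sum_univ_three, Real.norm_eq_abs, sq_abs]
    rw [h]
    nlinarith [sq_nonneg (x 2)]
  have hr : cylRadius x ≤ ‖z‖ + ‖c‖ := by
    refine hcyl.trans ?_
    have e : x = L (z - c) := by rw [hz, add_sub_cancel_right, LinearIsometryEquiv.apply_symm_apply]
    rw [e, L.norm_map]
    exact norm_sub_le z c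
  have hv0 : 0 ≤ ‖v t z‖ := norm_nonneg _
  have hA : ‖z‖ * ‖v t z‖ ≤ |D| := by
    calc ‖z‖ * ‖v t z‖ ≤ ‖z‖ * (D / (‖z‖ + Real.sqrt (-t))) := mul_le_mul_of_nonneg_left h1 (norm_nonneg _)
      _ ≤ ‖z‖ * (|D| / (‖z‖ + Real.sqrt (-t))) := by gcongr; exact le_abs_self D
      _ = |D| * (‖z‖ / (‖z‖ + Real.sqrt (-t))) := by ring
      _ ≤ |D| * 1 := by
          gcongr
          exact div_le_one_of_le₀ (by linarith [hst.le]) hden.le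
      _ = |D| := mul_one _
  have hB : ‖c‖ * ‖v t z‖ ≤ ‖c‖ * (|C| / Real.sqrt δ) := by
    refine mul_le_mul_of_nonneg_left ?_ (norm_nonneg _)
    calc ‖v t z‖ ≤ C / Real.sqrt (-t) := h2
      _ ≤ |C| / Real.sqrt (-t) := div_le_div_of_nonneg_right (le_abs_self C) hst.le
      _ ≤ |C| / Real.sqrt δ :=
          div_le_div_of_nonneg_left (abs_nonneg C) (Real.sqrt_pos.2 hδ) (Real.sqrt_le_sqrt (by linarith))
  calc cylRadius x * ‖v t z‖ ≤ (‖z‖ + ‖c‖) * ‖v t z‖ := mul_le_mul_of_nonneg_right hr hv0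
    _ = ‖z‖ * ‖v t z‖ + ‖c‖ * ‖v t z‖ := by ring
    _ ≤ |D| + ‖c‖ * (|C| / Real.sqrt δ) := add_le_add hA hB

/-- **Decay at spatial infinity of a slice of the translate–conjugate**: for fixed `t < 0` and every `ε > 0`,
`‖L v(t, L⁻¹x + c)‖ < ε` once `‖x‖` is large. -/
theorem eventually_norm_conj_translate_lt (hdec : HasTypeIDecay D v)
    (L : EuclideanSpace ℝ (Fin 3) ≃ₗᵢ[ℝ] EuclideanSpace ℝ (Fin 3)) (c : EuclideanSpace ℝ (Fin 3))
    {t : ℝ} (ht : t < 0) {ε : ℝ} (hε : 0 < ε) :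
    ∃ R : ℝ, ∀ x : EuclideanSpace ℝ (Fin 3), R ≤ ‖x‖ → ‖L (v t (L.symm x + c))‖ < ε := by
  refine ⟨‖c‖ + |D| / ε + 1, fun x hx => ?_⟩
  set z : EuclideanSpace ℝ (Fin 3) := L.symm x + c with hz
  have hst : 0 < Real.sqrt (-t) := Real.sqrt_pos.2 (by linarith)
  have hzx : ‖x‖ ≤ ‖z‖ + ‖c‖ := by
    have e : x = L (z - c) := by rw [hz, add_sub_cancel_right, LinearIsometryEquiv.apply_symm_apply]
    rw [e, L.norm_map]
    exact norm_sub_le z c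
  have hz1 : |D| / ε + 1 ≤ ‖z‖ := by linarith
  have hzpos : 0 < ‖z‖ := by
    have : 0 ≤ |D| / ε := div_nonneg (abs_nonneg D) hε.le
    linarith
  rw [L.norm_map]
  calc ‖v t z‖ ≤ D / (‖z‖ + Real.sqrt (-t)) := hdec t ht z
    _ ≤ |D| / (‖z‖ + Real.sqrt (-t)) := div_le_div_of_nonneg_right (le_abs_self D) (by positivity)
    _ ≤ |D| / ‖z‖ := div_le_div_of_nonneg_left (abs_nonneg D) hzpos (by linarith [hst.le])
    _ < ε := by
        rw [div_lt_iff₀ hzpos]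
        have h3 : |D| / ε * ε = |D| := div_mul_cancel₀ |D| hε.ne'
        nlinarith [hz1, h3, abs_nonneg D]

/-- **A periodic function which is small at infinity vanishes.** -/
theorem eq_zero_of_periodic_of_small_at_infinity {F : Type*} [NormedAddCommGroup F]
    {f : EuclideanSpace ℝ (Fin 3) → F} {p : EuclideanSpace ℝ (Fin 3)} (hp : p ≠ 0)
    (hper : ∀ x, f (x + p) = f x)
    (hsmall : ∀ ε : ℝ, 0 < ε → ∃ R : ℝ, ∀ x, R ≤ ‖x‖ → ‖f x‖ < ε) (x : EuclideanSpace ℝ (Fin 3)) :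
    f x = 0 := by
  have hiter : ∀ n : ℕ, f (x + (n : ℝ) • p) = f x := by
    intro n
    induction n with
    | zero => simp
    | succ k ih =>
      have e : x + ((k + 1 : ℕ) : ℝ) • p = (x + (k : ℝ) • p) + p := by
        rw [Nat.cast_succ, add_smul, one_smul, add_assoc]
      rw [e, hper, ih]
  rw [← norm_eq_zero]
  refine le_antisymm (le_of_forall_pos_lt_add fun ε hε => ?_) (norm_nonneg _)
  obtain ⟨R, hR⟩ := hsmall ε hε
  have hp' : 0 < ‖p‖ := norm_pos_iff.2 hp
  obtain ⟨n, hn⟩ := exists_nat_ge ((R + ‖x‖) / ‖p‖)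
  have hn' : R + ‖x‖ ≤ (n : ℝ) * ‖p‖ := by rwa [div_le_iff₀ hp'] at hn
  have hfar : R ≤ ‖x + (n : ℝ) • p‖ := by
    have h1 : ‖(n : ℝ) • p‖ = (n : ℝ) * ‖p‖ := by
      rw [norm_smul, Real.norm_of_nonneg (Nat.cast_nonneg n)]
    have h2 : ‖(n : ℝ) • p‖ - ‖x‖ ≤ ‖x + (n : ℝ) • p‖ := by
      have := norm_sub_norm_le ((n : ℝ) • p) (-x)
      rw [norm_neg, sub_neg_eq_add, add_comm] at this
      linarith [abs_le.1 (abs_norm_sub_norm_le ((n : ℝ) • p) (x + (n : ℝ) • p))]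
    linarith
  have h := hR _ hfar
  rw [hiter n] at h
  linarith

/-! ### One slice with axisymmetric VORTICITY about a vertical axis (swirl allowed) -/

/-- **(A′₁) with swirl, core form.**  A profile of the Type-I class with the shifted-slab bound `r‖v‖ ≤ C'(δ)`, ONE of
whose vorticity slices `curl v(s)` is axisymmetric about the vertical coordinate axis, vanishes identically.  The
kinematic and large-scale steps are nsreg-p7's (`…OneSliceCurlAxisymmetric.eq_zero_of_curl_axisymmetric_slice₀`,
verbatim): `v(s) − v(s)(0)` is axisymmetric (`sub_apply_zero_isAxisymmetric_of_curl`), the profile conjugated by `R_π`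
is in the class and its `s`-slice differs from `v(s)` by a constant, which therefore vanishes
(`eq_zero_of_slice_sub_eq_const`) — so `v(s)` itself is axisymmetric; then EVERY slice is (`isAxisymmetric_of_slice`)
and `eq_zero_of_isAxisymmetric_of_cylBound` (KNSS Thm 5.3) ends, where the poloidal original ended in KNSS Thm 5.2. -/
theorem eq_zero_of_curl_isAxisymmetric_slice_of_cylBound (hrate : HasTypeITimeDecay C v)
    (hcont : ContinuousOn (uncurry v) (Iio (0 : ℝ) ×ˢ univ))
    (hmild : ∀ s t : ℝ, s < t → t < 0 → ∀ x,
      v t x = UnboundedOperators.heatExtension (v s) (t - s) x - oseenDuhamel 1 s v v t x)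
    (hdiv : ∀ t < 0, VectorCalculus.IsDivFree (v t))
    (hbound : ∀ δ : ℝ, 0 < δ → ∃ C' : ℝ, ∀ t < -δ, ∀ y, cylRadius y * ‖v t y‖ ≤ C')
    {s : ℝ} (hs : s < 0) (haxi : IsAxisymmetric (curl (v s))) : ∀ t < 0, ∀ x, v t x = 0 := by
  -- adapted from `…PoloidalWindowRigidityOneSliceCurlAxisymmetric.eq_zero_of_curl_axisymmetric_slice₀` (nsreg-p7 g7)
  have hbdd := bdd_of_hasTypeITimeDecay hrate
  have hA : AnalyticOnNhd ℝ (v s) univ := analyticOnNhd_slice hcont hbdd hmild hs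
  have hV2 : ContDiff ℝ 2 (v s) := hA.contDiff
  set b : EuclideanSpace ℝ (Fin 3) := v s 0 with hb
  have hu : IsAxisymmetric (fun y => v s y - v s 0) :=
    sub_apply_zero_isAxisymmetric_of_curl hV2 (hdiv s hs) (fun y => hrate s hs y) haxi
  set L : EuclideanSpace ℝ (Fin 3) ≃ₗᵢ[ℝ] EuclideanSpace ℝ (Fin 3) := (rotZLIE Real.pi).symm with hL
  obtain ⟨hrate', hcont', hmild', -⟩ := class_conj_linearIsometryEquiv L hrate hcont hmild hdiv
  have hdiff : ∀ y, (fun t x => L (v t (L.symm x))) s y - v s y = rotZ (-Real.pi) b - b := by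
    intro y
    have h1 : v s (rotZ Real.pi y) - v s 0 = rotZ Real.pi (v s y - v s 0) := hu Real.pi y
    have h2 : v s (rotZ Real.pi y) = rotZ Real.pi (v s y - b) + b := by rw [hb]; rw [← h1]; abel
    show L (v s (L.symm y)) - v s y = rotZ (-Real.pi) b - b
    simp only [hL, LinearIsometryEquiv.symm_symm, rotZLIE_symm_apply, rotZLIE_apply]
    rw [h2, show rotZ (-Real.pi) (rotZ Real.pi (v s y - b) + b) =
      rotZ (-Real.pi) (rotZ Real.pi (v s y - b)) + rotZ (-Real.pi) b from map_add (rotZL (-Real.pi)) _ _,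
      ← rotZ_add, neg_add_cancel, rotZ_zero]
    abel
  have hzero : rotZ (-Real.pi) b - b = 0 :=
    eq_zero_of_slice_sub_eq_const hrate hcont hmild hrate' hcont' hmild' hs hdiff
  have hb0 : b 0 = 0 := by
    have h := congrArg (fun z : EuclideanSpace ℝ (Fin 3) => z 0) hzero
    simp only [PiLp.sub_apply, rotZ_apply_zero, Real.cos_neg, Real.cos_pi, Real.sin_neg, Real.sin_pi,
      PiLp.zero_apply] at h
    linarith
  have hb1 : b 1 = 0 := by
    have h := congrArg (fun z : EuclideanSpace ℝ (Fin 3) => z 1) hzero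
    simp only [PiLp.sub_apply, rotZ_apply_one, Real.cos_neg, Real.cos_pi, Real.sin_neg, Real.sin_pi,
      PiLp.zero_apply] at h
    linarith
  have haxv : IsAxisymmetric (fun y => v s (y + 0)) := by
    intro θ y
    simp only [add_zero]
    have h1 : v s (rotZ θ y) - v s 0 = rotZ θ (v s y - v s 0) := hu θ y
    have hbθ : rotZ θ b = b := rotZ_eq_self_of_horizontal_eq_zero hb0 hb1 θ
    have h2 : rotZ θ (v s y - b) = rotZ θ (v s y) - rotZ θ b := map_sub (rotZL θ) _ _
    rw [hb] at hbθ h2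
    rw [h2, hbθ] at h1
    have := sub_eq_sub_iff_add_eq_add.1 h1
    exact add_right_cancel this
  -- every slice is axisymmetric, and KNSS Thm 5.3 ends
  have hall := isAxisymmetric_of_slice hrate hcont hmild hdiv 0 hs haxv
  have hall' : ∀ t < 0, IsAxisymmetric (v t) := fun t ht => by
    simpa only [add_zero] using hall t ht
  exact eq_zero_of_isAxisymmetric_of_cylBound hrate hcont hmild hdiv hall' hbound

/-- **ONE slice with vorticity axisymmetric about ANY vertical axis ⇒ trivial (swirl allowed).**  A door-class profile
(with space–time Type-I decay `D` about the apex) one of whose vorticity slices is axisymmetric about the vertical axis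
through `c`, `curl v(s)(c + R_θ z) = R_θ curl v(s)(c + z)`, vanishes identically. -/
theorem eq_zero_of_curl_isAxisymmetric_slice (hrate : HasTypeITimeDecay C v) (hdec : HasTypeIDecay D v)
    (hcont : ContinuousOn (uncurry v) (Iio (0 : ℝ) ×ˢ univ))
    (hmild : ∀ s t : ℝ, s < t → t < 0 → ∀ x,
      v t x = UnboundedOperators.heatExtension (v s) (t - s) x - oseenDuhamel 1 s v v t x)
    (hdiv : ∀ t < 0, VectorCalculus.IsDivFree (v t)) (c : EuclideanSpace ℝ (Fin 3)) {s : ℝ} (hs : s < 0)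
    (haxi : IsAxisymmetric (fun y => curl (v s) (y + c))) : ∀ t < 0, ∀ x, v t x = 0 := by
  obtain ⟨hrate₁, hcont₁, hmild₁, hdiv₁⟩ := class_translate c hrate hcont hmild hdiv
  have hcurl : ∀ t (y : EuclideanSpace ℝ (Fin 3)), curl ((fun t y => v t (y + c)) t) y = curl (v t) (y + c) :=
    fun t y => curl_comp_add_const (v t) c y
  have haxi₁ : IsAxisymmetric (curl ((fun t y => v t (y + c)) s)) := by
    have e : curl ((fun t y => v t (y + c)) s) = fun y => curl (v s) (y + c) := funext (hcurl s)
    rw [e]; exact haxi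
  have hb := cylBound_conj_translate hrate hdec (LinearIsometryEquiv.refl ℝ (EuclideanSpace ℝ (Fin 3))) c
  have hb' : ∀ δ : ℝ, 0 < δ → ∃ C' : ℝ, ∀ t < -δ, ∀ y : EuclideanSpace ℝ (Fin 3),
      cylRadius y * ‖(fun t y => v t (y + c)) t y‖ ≤ C' := by
    intro δ hδ
    obtain ⟨C', hC'⟩ := hb δ hδ
    exact ⟨C', fun t ht y => hC' t ht y⟩
  have h := eq_zero_of_curl_isAxisymmetric_slice_of_cylBound hrate₁ hcont₁ hmild₁ hdiv₁ hb' hs haxi₁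
  intro t ht x
  simpa using h t ht (x - c)

/-- **Germ form (vertical axis).**  If on a nonempty open set of ONE slice the rotational Killing identity
`J ω_c(x) = Dω_c(x)[J x]` holds for `ω_c = curl (y ↦ v(s)(y + c))`, the door-class profile vanishes identically
(identity theorem `rotDefect_eq_zero_of_eqOn_open`, integration `isAxisymmetric_of_rotDefect_eq_zero`, then
`eq_zero_of_curl_isAxisymmetric_slice`). -/
theorem eq_zero_of_curl_rotDefect_eq_zero_on_open (hrate : HasTypeITimeDecay C v) (hdec : HasTypeIDecay D v)
    (hcont : ContinuousOn (uncurry v) (Iio (0 : ℝ) ×ˢ univ))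
    (hmild : ∀ s t : ℝ, s < t → t < 0 → ∀ x,
      v t x = UnboundedOperators.heatExtension (v s) (t - s) x - oseenDuhamel 1 s v v t x)
    (hdiv : ∀ t < 0, VectorCalculus.IsDivFree (v t)) {s : ℝ} (hs : s < 0) (c : EuclideanSpace ℝ (Fin 3))
    {S : Set (EuclideanSpace ℝ (Fin 3))} (hS : IsOpen S) (hne : S.Nonempty)
    (h : ∀ x ∈ S, rotGen (curl (fun y => v s (y + c)) x) = fderiv ℝ (curl (fun y => v s (y + c))) x (rotGen x)) :
    ∀ t < 0, ∀ x, v t x = 0 := by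
  obtain ⟨hrate', hcont', hmild', -⟩ := class_translate c hrate hcont hmild hdiv
  have hA : AnalyticOnNhd ℝ ((fun t y => v t (y + c)) s) univ :=
    analyticOnNhd_slice hcont' (bdd_of_hasTypeITimeDecay hrate') hmild' hs
  have hω : AnalyticOnNhd ℝ (curl (fun y => v s (y + c))) univ := analyticOnNhd_curl hA
  have hall := rotDefect_eq_zero_of_eqOn_open hω hS hne h
  have hax : IsAxisymmetric (curl (fun y => v s (y + c))) := isAxisymmetric_of_rotDefect_eq_zero hω.contDiff hall
  have hax' : IsAxisymmetric (fun y => curl (v s) (y + c)) := by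
    have e : curl (fun y => v s (y + c)) = fun y => curl (v s) (y + c) := funext fun y => curl_comp_add_const (v s) c y
    rw [← e]; exact hax
  exact eq_zero_of_curl_isAxisymmetric_slice hrate hdec hcont hmild hdiv c hs hax'

end Summit.NavierStokesRegularity.NavierStokesRegularity.Theorems.LocalTiltingFreeDoorAxisymmetricSwirl

end
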